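import Literature.Barriers.AnomalousDissipation.ShearFlowViscositySelectionPerturbedSheet
import Literature.Barriers.AnomalousDissipation.ShearFlowViscositySelectionWild
import HarnessLib

/-!
# Bardos–Titi–Wiedemann 2012, Thm. 5 perturbed at the Kelvin–Helmholtz scale: the flat vortex
sheet itself (barrier audit, gen 4, of `ShearFlowViscositySelectionSteps`)

Companion to `ShearFlowViscositySelectionPerturbedSheet.lean`, which proves the selection theorem
`BardosTitiWiedemann2012_thm5_perturbedData_sheet` for parallel shear data `(v₁(x₂),0,0)` whose
Fourier coefficients satisfy `|k₂||v̂₁(k₂)| ≤ M`, with modulus `exp(4M√(πT/ν))`. This file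
instantiates it on the datum of block (i) of the barrier `BardosTitiWiedemann2012_thm5`
(Bardos–Titi–Wiedemann 2012, Cor. 2; Székelyhidi 2011, Thm. 1.1 and (1)): the flat vortex-sheet
profile `vortexSheetProfile` (`1` on `(0,½)`, `-1` on `(-½,0)`), for which `M = 2/π`.

* `memLp_vortexSheetProfile` — `v₁ ∈ L²` (bounded, measurable; `ShearFlowViscositySelectionWild`).
* `abs_mul_norm_mFourierCoeff_vortexSheet_le` — `|k₂| · |𝓕(x ↦ v₁(x₂))(k)| ≤ 2/π` for every
  `k ∈ ℤ³`: off the `k₂`-axis the coefficient vanishes; on it, it is the one-dimensional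
  coefficient `∫_{-½}^{½} e^{-2πik₂y} sgn y dy = (e^{πik₂} + e^{-πik₂} - 2)/(-2πik₂)`
  (`= (1 - (-1)^{k₂})/(πik₂)`), of modulus `≤ 4/(2π|k₂|)` (Mathlib's `mFourier`/`fourier`,
  `UnitAddCircle.intervalIntegral_preimage`, `integral_exp_mul_complex`; the transport
  `Torus.volume_eq_pi_haarAddCircle` between the global volume and the local Haar volume of
  `Mathlib.Analysis.Fourier.AddCircleMulti`).
* `BardosTitiWiedemann2012_thm5_perturbedData_vortexSheet` — Leray–Hopf families with
  `‖u₀ʲ - v₀‖₂² exp((8/π)√(πT/ν_j)) → 0` converge weak-* to the steady vortex sheet.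

## References

* C. Bardos, E. S. Titi, E. Wiedemann, C. R. Math. Acad. Sci. Paris 350 (2012) 757–760, Thm. 5,
  Cor. 2 (`BardosTitiWiedemann2012`).
* L. Székelyhidi Jr., C. R. Math. Acad. Sci. Paris 349 (2011) 1063–1066, (1), Thm. 1.1
  (`Szekelyhidi2011`).
-/

open MeasureTheory Set Filter Topology UnitAddTorus Function
open scoped ENNReal NNReal InnerProductSpace

noncomputable section

namespace Literature.Barriers.AnomalousDissipation

open Literature.Analysis.FluidPDE Literature.Analysis.FunctionSpaces Literature.Analysis.FunctionSpaces.Torus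

/-- The vortex-sheet profile is square integrable (bounded by `1`, measurable). [folklore] -/
theorem memLp_vortexSheetProfile : MemLp vortexSheetProfile 2 volume :=
  MemLp.of_bound measurable_vortexSheetProfile.aestronglyMeasurable 1
    (ae_of_all _ fun s => by rw [Real.norm_eq_abs]; exact abs_vortexSheetProfile_le s)

/-- **The Fourier coefficients of Székelyhidi's vortex sheet are `O(1/|k₂|)` with constant
`2/π`.** For the flat vortex-sheet profile `v₁ = 1` on `(0,½)`, `-1` on `(-½,0)` and every
frequency `k ∈ ℤ³`: `|k₂| · |𝓕(x ↦ v₁(x₂))(k)| ≤ 2/π` (the coefficient vanishes off the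
`k₂`-axis; on it, `v̂₁(k₂) = ∫_{-½}^{½} e^{-2πik₂y} sgn(y) dy = (e^{πik₂} + e^{-πik₂} - 2)/(-2πik₂)`,
of modulus at most `4/(2π|k₂|)`; in fact `= (1-(-1)^{k₂})/(πik₂)`). [folklore] -/
theorem abs_mul_norm_mFourierCoeff_vortexSheet_le (k : Fin 3 → ℤ) :
    |(k 1 : ℝ)| * ‖mFourierCoeff (fun x : UnitAddTorus (Fin 3) => ((vortexSheetProfile (x 1) : ℝ) : ℂ)) k‖ ≤
      2 / Real.pi := by
  have hπ := Real.pi_pos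
  by_cases hk : k 0 = 0 ∧ k 2 = 0
  swap
  · have hz : mFourierCoeff (fun x : UnitAddTorus (Fin 3) => ((vortexSheetProfile (x 1) : ℝ) : ℂ)) k = 0 := by
      rcases not_and_or.1 hk with h0 | h2
      · exact mFourierCoeff_eq_zero_of_forall_add_single (i := 0) (fun s x => by simp) h0
      · exact mFourierCoeff_eq_zero_of_forall_add_single (i := 2) (fun s x => by simp) h2
    rw [hz, norm_zero, mul_zero]; positivity
  by_cases hn : k 1 = 0
  · rw [hn, Int.cast_zero, abs_zero, zero_mul]; positivity
  set n : ℤ := k 1 with hndef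
  -- ### the `T³` coefficient is a one-dimensional integral
  set g : UnitAddCircle → ℂ := fun y => fourier (-n) y * ((vortexSheetProfile y : ℝ) : ℂ) with hg
  have hgm : Measurable g :=
    (fourier (-n)).continuous.measurable.mul (Complex.measurable_ofReal.comp measurable_vortexSheetProfile)
  have hg_bound : ∀ y, ‖g y‖ ≤ 1 := fun y => by
    rw [hg, norm_mul, Complex.norm_real, Real.norm_eq_abs]
    have h1 : ‖fourier (-n) y‖ = 1 := by
      rw [fourier_apply]; exact Circle.norm_coe _
    rw [h1, one_mul]; exact abs_vortexSheetProfile_le y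
  have hA : mFourierCoeff (fun x : UnitAddTorus (Fin 3) => ((vortexSheetProfile (x 1) : ℝ) : ℂ)) k =
      ∫ y : UnitAddCircle, g y := by
    have hmode : ∀ x : UnitAddTorus (Fin 3), mFourier (-k) x = fourier (-n) (x 1) := by
      intro x
      simp only [mFourier, ContinuousMap.coe_mk, Fin.prod_univ_three, Pi.neg_apply, hk.1, hk.2, neg_zero,
        fourier_zero, one_mul, mul_one, hndef]
    unfold mFourierCoeff
    change ∫ t, mFourier (-k) t • ((vortexSheetProfile (t 1) : ℝ) : ℂ) ∂(Measure.pi fun _ : Fin 3 => AddCircle.haarAddCircle) = _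
    rw [← volume_eq_pi_haarAddCircle]
    simp_rw [hmode, smul_eq_mul]
    have h := integral_map (μ := (volume : Measure (UnitAddTorus (Fin 3)))) (φ := fun x : UnitAddTorus (Fin 3) => x 1)
      (measurable_pi_apply 1).aemeasurable (f := g) (by rw [measurePreserving_eval_one.map_eq]; exact hgm.aestronglyMeasurable)
    rw [measurePreserving_eval_one.map_eq] at h
    exact h.symm
  -- ### as an interval integral over the fundamental interval `(-½, ½]`
  have hB : ∫ y : UnitAddCircle, g y = ∫ x in (-(1 / 2 : ℝ))..(-(1 / 2 : ℝ) + 1), g x :=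
    (UnitAddCircle.intervalIntegral_preimage _ g).symm
  set c : ℂ := -(2 * Real.pi * n) * Complex.I with hc
  have hnorm_c : ‖c‖ = 2 * Real.pi * |(n : ℝ)| := by
    rw [hc, norm_mul, Complex.norm_I, mul_one, norm_neg]
    rw [norm_mul, Complex.norm_intCast, show ‖(2 * Real.pi : ℂ)‖ = 2 * Real.pi by
      rw [show (2 * Real.pi : ℂ) = ((2 * Real.pi : ℝ) : ℂ) by push_cast; rfl, Complex.norm_real, Real.norm_eq_abs,
        abs_of_pos (by positivity)]]
  have hc0 : c ≠ 0 := by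
    rw [← norm_pos_iff, hnorm_c]
    have : (0 : ℝ) < |(n : ℝ)| := abs_pos.2 (by exact_mod_cast hn)
    positivity
  have hfour : ∀ x : ℝ, fourier (-n) (x : UnitAddCircle) = Complex.exp (c * x) := by
    intro x
    rw [fourier_coe_apply]
    congr 1
    rw [hc]; push_cast; ring
  have hprof : ∀ x : ℝ, x ∈ Ico (-(1 / 2 : ℝ)) (1 / 2) →
      vortexSheetProfile (x : UnitAddCircle) = if 0 < x then 1 else -1 := by
    intro x hx
    unfold vortexSheetProfile
    exact AddCircle.liftIco_coe_apply (by rwa [show -(1 / 2 : ℝ) + 1 = 1 / 2 by norm_num])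
  -- ### integrability on the two halves
  have hgi : ∀ a b : ℝ, IntervalIntegrable (fun x : ℝ => g x) volume a b := by
    intro a b
    refine (intervalIntegrable_const (c := (1 : ℝ))).mono_fun' ?_ (ae_of_all _ fun x => hg_bound _)
    exact (hgm.comp AddCircle.measurable_mk').aestronglyMeasurable
  -- ### left half: `g = -e^{cx}` on `[-½, 0]`
  have hL : ∫ x in (-(1 / 2 : ℝ))..0, g x = ∫ x in (-(1 / 2 : ℝ))..0, -Complex.exp (c * x) := by
    refine intervalIntegral.integral_congr fun x hx => ?_
    rw [uIcc_of_le (by norm_num)] at hx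
    simp only [hg]
    rw [hfour x, hprof x ⟨hx.1, by linarith [hx.2]⟩, if_neg (not_lt.2 hx.2)]
    push_cast; ring
  -- ### right half: `g = e^{cx}` a.e. on `(0, ½]`
  have hR : ∫ x in (0 : ℝ)..(1 / 2), g x = ∫ x in (0 : ℝ)..(1 / 2), Complex.exp (c * x) := by
    refine intervalIntegral.integral_congr_ae ?_
    have hne : ∀ᵐ x : ℝ, x ≠ 1 / 2 := by
      simp only [ae_iff, not_not, setOf_eq_eq_singleton, Real.volume_singleton]
    filter_upwards [hne] with x hx hxI
    rw [uIoc_of_le (by norm_num)] at hxI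
    simp only [hg]
    rw [hfour x, hprof x ⟨by linarith [hxI.1], lt_of_le_of_ne hxI.2 hx⟩, if_pos hxI.1]
    push_cast; ring
  -- ### evaluate and bound
  have hI : ∫ x in (-(1 / 2 : ℝ))..(-(1 / 2 : ℝ) + 1), g x =
      (Complex.exp (c * (-(1 / 2 : ℝ))) - 1) / c + (Complex.exp (c * (1 / 2 : ℝ)) - 1) / c := by
    rw [show (-(1 / 2 : ℝ) + 1) = 1 / 2 by norm_num,
      ← intervalIntegral.integral_add_adjacent_intervals (hgi _ 0) (hgi 0 _), hL, hR,
      intervalIntegral.integral_neg, integral_exp_mul_complex hc0, integral_exp_mul_complex hc0]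
    push_cast
    simp only [mul_zero, Complex.exp_zero]
    ring
  have hunit : ∀ x : ℝ, ‖Complex.exp (c * x)‖ = 1 := fun x => by
    rw [hc, show -(2 * Real.pi * n) * Complex.I * (x : ℂ) = ((-(2 * Real.pi * n * x) : ℝ) : ℂ) * Complex.I by
      push_cast; ring, Complex.norm_exp_ofReal_mul_I]
  have hunitneg : ∀ x : ℝ, ‖Complex.exp (c * -(x : ℂ))‖ = 1 := fun x => by
    rw [← Complex.ofReal_neg]; exact hunit (-x)
  have hbound : ‖∫ x in (-(1 / 2 : ℝ))..(-(1 / 2 : ℝ) + 1), g x‖ ≤ 4 / ‖c‖ := by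
    rw [hI, ← add_div, norm_div]
    gcongr
    calc ‖(Complex.exp (c * (-(1 / 2 : ℝ))) - 1) + (Complex.exp (c * (1 / 2 : ℝ)) - 1)‖
        ≤ ‖Complex.exp (c * (-(1 / 2 : ℝ))) - 1‖ + ‖Complex.exp (c * (1 / 2 : ℝ)) - 1‖ := norm_add_le _ _
      _ ≤ (‖Complex.exp (c * (-(1 / 2 : ℝ)))‖ + ‖(1 : ℂ)‖) + (‖Complex.exp (c * (1 / 2 : ℝ))‖ + ‖(1 : ℂ)‖) :=
          add_le_add (norm_sub_le _ _) (norm_sub_le _ _)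
      _ = 4 := by rw [hunitneg, hunit, norm_one]; norm_num
  rw [hA, hB]
  calc |(n : ℝ)| * ‖∫ x in (-(1 / 2 : ℝ))..(-(1 / 2 : ℝ) + 1), g x‖ ≤ |(n : ℝ)| * (4 / ‖c‖) :=
        mul_le_mul_of_nonneg_left hbound (abs_nonneg _)
    _ = 2 / Real.pi := by
        rw [hnorm_c]
        have : (0 : ℝ) < |(n : ℝ)| := abs_pos.2 (by exact_mod_cast hn)
        field_simp
        ring


/-- **Bardos–Titi–Wiedemann 2012, Thm. 5, perturbed at the Kelvin–Helmholtz scale, for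
Székelyhidi's vortex sheet itself** (the datum of block (i) / Cor. 2 with `v₃ = 0`). Let
`v₀ = (v₁(x₂), 0, 0)` with `v₁` the flat vortex-sheet profile (`1` on `(0,½)`, `-1` on `(-½,0)`),
`T > 0`, `ν_j > 0`, `ν_j → 0`, and let `u_j` be Leray–Hopf weak solutions of the unforced
Navier–Stokes equations on `T³ × [0,T)` with viscosity `ν_j` and arbitrary `L²` data `u₀ʲ` such
that `‖u₀ʲ - v₀‖₂² · exp((8/π)√(πT/ν_j)) → 0`. Then `u_j ⇀* v₀`, the steady vortex sheet, in
`L^∞(0,T;L²(T³))` — whereas with the exact datum there are infinitely many other admissible Euler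
solutions (Bardos–Titi–Wiedemann 2012, Cor. 2; Székelyhidi 2011, Thm. 1.1), none of which is
therefore reachable by Leray–Hopf families this close to the sheet.
`BardosTitiWiedemann2012_thm5_perturbedData_sheet` with `M = 2/π`
(`abs_mul_norm_mFourierCoeff_vortexSheet_le`). [cite: BardosTitiWiedemann2012, Thm. 5 and Cor. 2] [cite: Szekelyhidi2011, Thm. 1.1] -/
theorem BardosTitiWiedemann2012_thm5_perturbedData_vortexSheet {T : ℝ} (hT : 0 < T) (ν : ℕ → ℝ)
    (hν : ∀ j, 0 < ν j) (hν₀ : Tendsto ν atTop (𝓝 0))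
    (u₀ : ℕ → UnitAddTorus (Fin 3) → EuclideanSpace ℝ (Fin 3)) (hu₀ : ∀ j, MemLp (u₀ j) 2 volume)
    (u : ℕ → ℝ → UnitAddTorus (Fin 3) → EuclideanSpace ℝ (Fin 3))
    (hu : ∀ j, Torus.IsLerayHopfOn T (ν j) 0 (u₀ j) (u j))
    (hclose : Tendsto (fun j => (∫ x, ‖u₀ j x - shearData vortexSheetProfile 0 x‖ ^ 2) *
        Real.exp (8 / Real.pi * Real.sqrt (Real.pi * T / ν j))) atTop (𝓝 0)) :
    Torus.TendstoWeakStar u (shearFlow vortexSheetProfile 0) T := by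
  refine BardosTitiWiedemann2012_thm5_perturbedData_sheet vortexSheetProfile memLp_vortexSheetProfile
    (M := 2 / Real.pi) abs_mul_norm_mFourierCoeff_vortexSheet_le hT ν hν hν₀ u₀ hu₀ u hu ?_
  refine hclose.congr fun j => ?_
  congr 2
  ring

end Literature.Barriers.AnomalousDissipation

end
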